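import Summits.QuantumFields.BalabanUV.T4Continuum.Support.DirichletDirectionalBesovCutoff
import Summits.QuantumFields.BalabanUV.Beta.GAN24.DirichletBoxTrace

/-!
# `BalabanUV.T4Continuum.Support.DirichletMonotoneCutoff` — NE2 (node U1a) formalisation swarm, SUPPLIER item «Δ1-BESOV» under the
# owner's sub-row `T4-U1a.S-NE2-D1-DIRICHLET°` (wall `hinj`): module (II) — LOCALLY MONOTONE UNIONS OF UNIT BLOCKS AND THE
# CONSTRUCTION OF THEIR ADMISSIBLE DIRECTIONAL CUTOFFS from cubic-smoothstep product bumps — file 1 of 2: the smoothstep ramps, the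
# block coordinates and the vertex bumps (§1–§3); file 2 `DirichletMonotoneCutoffBounds` = the difference bounds and the END (§4–§5)
# (unit b2b-balaban-t4-ne2-formalise-leaf-08, gen 3, v1)

HONEST FRAMING.  Rung (B)+1 bookkeeping at MODEL level, finite torus; pure lattice combinatorics ∕ real polynomial inequalities; NE2 (U1a)
is NOT proved by this file; spine PROVED 0/9 unchanged; NOT infinite volume, NOT the mass gap, NOT Clay.  HONEST DEPENDENCY (verbatim):
«continuum YM on T⁴ ⇐ BetaPertH ∧ nine spine estimates (0/9 proved); BetaPertH ⇐ (D1) ∧ (D4) ∧ CAP+tail; G-an2-4 gates asym, D1 and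
NE2/3/4.»

WHAT THIS FILE PROVES (0 sorry).  On the fine torus `Tor (fine n M)` tiled by unit blocks of `n^d` sites (`B5Blocks16.bpt/blockOf`),
for a set `S` of unit blocks and its BLOCK REGION `blockReg n M S` (`Beta/GAN24/DirichletBoxTrace.blockReg`):
 * §1 the cubic smoothstep `s(τ) = 3τ² − 2τ³` (`s(1−τ) = 1 − s(τ)`, `|s(a) − s(b)| ≤ (3/2)|a − b|`, EXACT second difference
   `6h²(1 − 2τ)`, `s(h) ≤ 3h²`) and the in-block ramps `rampUp n t = s(t/(n−1))`, `rampDn = 1 − rampUp`;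
 * §2 the offset `offsF x` of a site in its block and the TRANSLATION LEMMAS (moving by `+e_ν` raises the `ν`-offset, or crosses into the
   block `blockOf x + e_ν` at offset `0`);
 * §3 the VERTEX BUMPS `bump v x = Π_ν θ_ν` (`θ_ν = rampUp` on the lower block of the patch of the vertex `v`, `rampDn` on the upper
   block, `0` elsewhere) — an EXACT PARTITION OF UNITY `Σ_v bump v x = 1`, `0 ≤ bump ≤ 1`;
 * §4 their first and PURE second differences: `Σ_v |bump v (x+e_ν) − bump v x| ≤ 3/(n−1)`,
   `Σ_v |2·bump v x − bump v (x+e_ν) − bump v (x−e_ν)| ≤ 12/(n−1)²` (the sum over vertices FACTORISES axis by axis);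
 * §5 [shape] **`LocallyMonotone S`**: at every vertex `v` and axis `μ` the `2^d` blocks around `v` are DOWNWARD-closed (upper ∈ S ⇒
   lower ∈ S, columnwise) or UPWARD-closed along `μ`; the cutoff `psi S μ = Σ_{v downward-closed along μ} bump v` and the END
   **`admissibleCutoff_psi`**: `2 ≤ n → LocallyMonotone S → AdmissibleCutoff (fine n M) (blockReg n M S) μ (psi S μ) (3/(n−1)) (12/(n−1)²)`,
   with the unit-scale corollary **`exists_admissibleCutoff`** (`ℓ₁ = 6/n`, `ℓ₂ = 48/n²`, the shape module (III) consumes).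
 What is NOT locally monotone (located, prose): the checkerboard pair at a vertex (bond-decoupled on the lattice, harmless) and the
 face-connected non-Lipschitz 4-chain of cubes winding around a vertex (d ≥ 3) — for such configurations the one-sided translation
 method has no admissible sign along one axis; leaf-07-g4's numerics (`t4/T4-EST-NE2-D1-INJ.md`) suggest the law still holds there.

ABSOLUTE RULE (cell, verbatim): «No internally-minted statement may enter as a cited fact. Every hypothesis is either kernel-proved in
this package or a verbatim quotation of a PUBLISHED theorem with page reference. The manuscript(s) under audit are NOT citable for
their own disputed steps — they are the thing under adjudication; programme-internal (2001/route/tribunal) claims are never citable.»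
[folklore] throughout; parametrised shape predicates (`InPatch`, `DownClosed`, `UpClosed`, `LocallyMonotone`) and data defs only; no
`def … : Prop` fact.  NOT CLAIMED: anything about non-monotone regions; NE2; NE3; «not in print; our construction».
-/

noncomputable section

open scoped BigOperators
open Finset

namespace Summit.QuantumFields.BalabanUV.T4Continuum.DirichletMonotoneCutoff

open Literature.MathematicalPhysics.QuantumFieldTheory.Balaban1983to89.B5Prop11Plancherel (Tor fine unitVec)
open Literature.MathematicalPhysics.QuantumFieldTheory.Balaban1983to89.B5Block118 (tstep tstep_zero tstep_succ bpt iota up up_add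
  up_unitVec)
open Literature.MathematicalPhysics.QuantumFieldTheory.Balaban1983to89.B5Blocks16 (blockOf blockOf_bpt bpt_bijective bpt_val)
open Summit.QuantumFields.BalabanUV.T4Continuum.DirichletDirectionalBesovCutoff (AdmissibleCutoff)
open Summit.QuantumFields.BalabanUV.Beta.GAN24.DirichletBoxTrace (blockReg bpt_val_mod bpt_update_add_tstep bpt_eq_update_add)
open Summit.QuantumFields.BalabanUV.T4Continuum.VectorBlockTrialForm (tstep_add)

variable {d : ℕ}

/-! ## §1 The cubic smoothstep and the in-block ramps -/

/-- the cubic smoothstep `s(τ) = 3τ² − 2τ³` (`C¹` ramp from `s(0) = 0` to `s(1) = 1`, `s′(0) = s′(1) = 0`). [folklore] -/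
def sstep (τ : ℝ) : ℝ := 3 * τ ^ 2 - 2 * τ ^ 3

/-- `s(0) = 0`. [folklore] -/
theorem sstep_zero : sstep 0 = 0 := by norm_num [sstep]

/-- `s(1) = 1`. [folklore] -/
theorem sstep_one : sstep 1 = 1 := by norm_num [sstep]

/-- the symmetry `s(1 − τ) = 1 − s(τ)`. [folklore] -/
theorem sstep_symm (τ : ℝ) : sstep (1 - τ) = 1 - sstep τ := by unfold sstep; ring

/-- `0 ≤ s ≤ 1` on `[0, 1]`. [folklore] -/
theorem sstep_mem {τ : ℝ} (h0 : 0 ≤ τ) (h1 : τ ≤ 1) : 0 ≤ sstep τ ∧ sstep τ ≤ 1 := by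
  unfold sstep
  constructor <;> nlinarith [mul_nonneg h0 h0, mul_nonneg (mul_nonneg h0 h0) h0, mul_nonneg (mul_nonneg h0 h0) (sub_nonneg.mpr h1),
    mul_nonneg h0 (sub_nonneg.mpr h1), sub_nonneg.mpr h1]

/-- the Lipschitz bound `|s(a) − s(b)| ≤ (3/2)|a − b|` on `[0, 1]` (`max |s′| = 3/2`). [folklore] -/
theorem sstep_lip {a b : ℝ} (ha0 : 0 ≤ a) (ha1 : a ≤ 1) (hb0 : 0 ≤ b) (hb1 : b ≤ 1) :
    |sstep a - sstep b| ≤ 3 / 2 * |a - b| := by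
  have hfac : sstep a - sstep b = (a - b) * (3 * (a + b) - 2 * (a ^ 2 + a * b + b ^ 2)) := by unfold sstep; ring
  rw [hfac, abs_mul, mul_comm]
  refine mul_le_mul_of_nonneg_right ?_ (abs_nonneg _)
  rw [abs_le]
  constructor
  · nlinarith [mul_nonneg ha0 hb0, mul_nonneg ha0 (sub_nonneg.mpr ha1), mul_nonneg hb0 (sub_nonneg.mpr hb1),
      mul_nonneg (sub_nonneg.mpr ha1) (sub_nonneg.mpr hb1), mul_nonneg ha0 (sub_nonneg.mpr hb1), mul_nonneg hb0 (sub_nonneg.mpr ha1)]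
  · nlinarith [sq_nonneg (a + b - 1), sq_nonneg (a - b), mul_nonneg ha0 hb0]

/-- the EXACT second difference `s(τ + h) − 2s(τ) + s(τ − h) = 6h²(1 − 2τ)`. [folklore] -/
theorem sstep_second_diff (τ h : ℝ) : sstep (τ + h) - 2 * sstep τ + sstep (τ - h) = 6 * h ^ 2 * (1 - 2 * τ) := by
  unfold sstep; ring

/-- hence `|s(τ + h) − 2s(τ) + s(τ − h)| ≤ 6h²` for `τ ∈ [0, 1]`. [folklore] -/
theorem abs_sstep_second_diff_le {τ : ℝ} (h0 : 0 ≤ τ) (h1 : τ ≤ 1) (h : ℝ) :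
    |sstep (τ + h) - 2 * sstep τ + sstep (τ - h)| ≤ 6 * h ^ 2 := by
  rw [sstep_second_diff, abs_mul, abs_of_nonneg (by positivity : (0 : ℝ) ≤ 6 * h ^ 2)]
  refine mul_le_of_le_one_right (by positivity) ?_
  rw [abs_le]; constructor <;> linarith

/-- near the plateau: `s(h) ≤ 3h²` for `h ≥ 0`. [folklore] -/
theorem sstep_le_three_sq {h : ℝ} (h0 : 0 ≤ h) : sstep h ≤ 3 * h ^ 2 := by
  unfold sstep; nlinarith [pow_nonneg h0 3]

/-- the rising in-block ramp `rampUp n t = s(t/(n−1))` (`t` = offset `0 … n−1`): `0` on the first layer, `1` on the last. [folklore] -/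
def rampUp (n t : ℕ) : ℝ := sstep ((t : ℝ) / ((n : ℝ) - 1))

/-- the falling ramp `rampDn = 1 − rampUp`. [folklore] -/
def rampDn (n t : ℕ) : ℝ := 1 - rampUp n t

section Ramps

variable {n : ℕ} (hn : 2 ≤ n)
include hn

/-- `n − 1 > 0` as a real. [folklore] -/
theorem pred_pos : 0 < (n : ℝ) - 1 := by
  have : (2 : ℝ) ≤ n := by exact_mod_cast hn
  linarith

/-- the normalised offset `t/(n−1) ∈ [0,1]` for `t ≤ n − 1`. [folklore] -/
theorem ratio_mem {t : ℕ} (ht : t + 1 ≤ n) : 0 ≤ (t : ℝ) / ((n : ℝ) - 1) ∧ (t : ℝ) / ((n : ℝ) - 1) ≤ 1 := by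
  have hp := pred_pos hn
  refine ⟨div_nonneg (Nat.cast_nonneg t) hp.le, ?_⟩
  rw [div_le_one hp]
  have : ((t + 1 : ℕ) : ℝ) ≤ n := by exact_mod_cast ht
  push_cast at this; linarith

/-- `0 ≤ rampUp ≤ 1` on a block. [folklore] -/
theorem rampUp_mem {t : ℕ} (ht : t + 1 ≤ n) : 0 ≤ rampUp n t ∧ rampUp n t ≤ 1 :=
  sstep_mem (ratio_mem hn ht).1 (ratio_mem hn ht).2

/-- `0 ≤ rampDn ≤ 1` on a block. [folklore] -/
theorem rampDn_mem {t : ℕ} (ht : t + 1 ≤ n) : 0 ≤ rampDn n t ∧ rampDn n t ≤ 1 := by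
  have h := rampUp_mem hn ht; unfold rampDn; constructor <;> linarith [h.1, h.2]

omit hn in
/-- `rampUp n 0 = 0`. [folklore] -/
theorem rampUp_zero : rampUp n 0 = 0 := by simp [rampUp, sstep_zero]

/-- `rampUp n (n−1) = 1`. [folklore] -/
theorem rampUp_last : rampUp n (n - 1) = 1 := by
  have hp := pred_pos hn
  unfold rampUp
  rw [Nat.cast_sub (by omega : 1 ≤ n), Nat.cast_one, div_self hp.ne', sstep_one]

omit hn in
/-- `rampDn n 0 = 1`. [folklore] -/
theorem rampDn_zero : rampDn n 0 = 1 := by rw [rampDn, rampUp_zero, sub_zero]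

/-- `rampDn n (n−1) = 0`. [folklore] -/
theorem rampDn_last : rampDn n (n - 1) = 0 := by rw [rampDn, rampUp_last hn, sub_self]

/-- one offset step changes `rampUp` by at most `3/(2(n−1))`. [folklore] -/
theorem rampUp_step_le {t : ℕ} (ht : t + 2 ≤ n) : |rampUp n (t + 1) - rampUp n t| ≤ 3 / 2 * (1 / ((n : ℝ) - 1)) := by
  have hp := pred_pos hn
  have h1 := ratio_mem hn (show t + 1 + 1 ≤ n by omega)
  have h0 := ratio_mem hn (show t + 1 ≤ n by omega)
  unfold rampUp
  refine (sstep_lip h1.1 h1.2 h0.1 h0.2).trans (le_of_eq ?_)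
  congr 1
  rw [Nat.cast_succ, ← sub_div, add_sub_cancel_left, abs_of_nonneg (div_nonneg zero_le_one hp.le)]

/-- one offset step changes `rampDn` by at most `3/(2(n−1))`. [folklore] -/
theorem rampDn_step_le {t : ℕ} (ht : t + 2 ≤ n) : |rampDn n (t + 1) - rampDn n t| ≤ 3 / 2 * (1 / ((n : ℝ) - 1)) := by
  rw [show rampDn n (t + 1) - rampDn n t = -(rampUp n (t + 1) - rampUp n t) by unfold rampDn; ring, abs_neg]
  exact rampUp_step_le hn ht

/-- interior second difference of `rampUp`: `|2·r(t) − r(t+1) − r(t−1)| ≤ 6/(n−1)²` (`1 ≤ t ≤ n − 2`). [folklore] -/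
theorem rampUp_second_le {t : ℕ} (ht1 : 1 ≤ t) (ht : t + 2 ≤ n) :
    |2 * rampUp n t - rampUp n (t + 1) - rampUp n (t - 1)| ≤ 6 * (1 / ((n : ℝ) - 1)) ^ 2 := by
  have hp := pred_pos hn
  have h0 := ratio_mem hn (show t + 1 ≤ n by omega)
  have e1 : ((t + 1 : ℕ) : ℝ) / ((n : ℝ) - 1) = (t : ℝ) / ((n : ℝ) - 1) + 1 / ((n : ℝ) - 1) := by push_cast; ring
  have e2 : ((t - 1 : ℕ) : ℝ) / ((n : ℝ) - 1) = (t : ℝ) / ((n : ℝ) - 1) - 1 / ((n : ℝ) - 1) := by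
    rw [Nat.cast_sub ht1]; push_cast; ring
  unfold rampUp
  rw [e1, e2, show 2 * sstep ((t : ℝ) / ((n : ℝ) - 1)) - sstep ((t : ℝ) / ((n : ℝ) - 1) + 1 / ((n : ℝ) - 1))
      - sstep ((t : ℝ) / ((n : ℝ) - 1) - 1 / ((n : ℝ) - 1))
      = -(sstep ((t : ℝ) / ((n : ℝ) - 1) + 1 / ((n : ℝ) - 1)) - 2 * sstep ((t : ℝ) / ((n : ℝ) - 1))
          + sstep ((t : ℝ) / ((n : ℝ) - 1) - 1 / ((n : ℝ) - 1))) by ring, abs_neg]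
  exact abs_sstep_second_diff_le h0.1 h0.2 _

/-- interior second difference of `rampDn`. [folklore] -/
theorem rampDn_second_le {t : ℕ} (ht1 : 1 ≤ t) (ht : t + 2 ≤ n) :
    |2 * rampDn n t - rampDn n (t + 1) - rampDn n (t - 1)| ≤ 6 * (1 / ((n : ℝ) - 1)) ^ 2 := by
  rw [show 2 * rampDn n t - rampDn n (t + 1) - rampDn n (t - 1) = -(2 * rampUp n t - rampUp n (t + 1) - rampUp n (t - 1)) by
    unfold rampDn; ring, abs_neg]
  exact rampUp_second_le hn ht1 ht

/-- the boundary second differences: `rampUp n 1 ≤ 3/(n−1)²` … [folklore] -/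
theorem rampUp_one_le : |rampUp n 1| ≤ 3 * (1 / ((n : ℝ) - 1)) ^ 2 := by
  have hp := pred_pos hn
  have h := ratio_mem hn (show 1 + 1 ≤ n by omega)
  simp only [Nat.cast_one] at h
  unfold rampUp
  rw [Nat.cast_one, abs_of_nonneg (sstep_mem h.1 h.2).1]
  refine (sstep_le_three_sq h.1).trans (le_of_eq ?_); ring

/-- … and `1 − rampUp n (n−2) ≤ 3/(n−1)²`. [folklore] -/
theorem one_sub_rampUp_le : |1 - rampUp n (n - 2)| ≤ 3 * (1 / ((n : ℝ) - 1)) ^ 2 := by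
  have hp := pred_pos hn
  have e : ((n - 2 : ℕ) : ℝ) / ((n : ℝ) - 1) = 1 - 1 / ((n : ℝ) - 1) := by
    rw [Nat.cast_sub hn]; push_cast; field_simp; ring
  have h := ratio_mem hn (show 1 + 1 ≤ n by omega)
  rw [Nat.cast_one] at h
  unfold rampUp
  rw [e, sstep_symm, sub_sub_cancel, abs_of_nonneg (sstep_mem h.1 h.2).1]
  refine (sstep_le_three_sq h.1).trans (le_of_eq ?_); ring

end Ramps

/-! ## §2 Block coordinates of a site and the translation lemmas -/

section Blocks

variable (n : ℕ) [NeZero n] (M : Fin d → ℕ) [hM : ∀ μ, NeZero (M μ)]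

/-- the offset `j ∈ {0,…,n−1}^d` of a site in its block (`x = bpt (blockOf x) (offsF x)`). [folklore] -/
def offsF (x : Tor (fine n M)) : Fin d → Fin n := ((Equiv.ofBijective _ (bpt_bijective n M)).symm x).2

/-- `x = bpt (blockOf x) (offsF x)`. [folklore] -/
theorem bpt_blockOf_offsF (x : Tor (fine n M)) : bpt n M (blockOf n M x) (offsF n M x) = x :=
  (Equiv.ofBijective _ (bpt_bijective n M)).apply_symm_apply x

/-- `offsF (bpt b j) = j`. [folklore] -/
theorem offsF_bpt (b : Tor M) (j : Fin d → Fin n) : offsF n M (bpt n M b j) = j := by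
  have h : (Equiv.ofBijective _ (bpt_bijective n M)).symm (bpt n M b j) = (b, j) :=
    (Equiv.ofBijective _ (bpt_bijective n M)).symm_apply_apply (b, j)
  rw [offsF, h]

omit [NeZero n] hM in
/-- `tstep μ 1 = e_μ`. [folklore] -/
theorem tstep_one' (μ : Fin d) : tstep (fine n M) μ 1 = unitVec (fine n M) μ := by
  rw [tstep_succ, tstep_zero, zero_add]

omit hM in
/-- **translation inside a block**: `bpt b j + e_μ = bpt b j[μ ↦ j_μ + 1]` when `j_μ + 1 < n`. [folklore] -/
theorem bpt_add_unitVec_of_lt (b : Tor M) (j : Fin d → Fin n) (μ : Fin d) (h : (j μ : ℕ) + 1 < n) :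
    bpt n M b j + unitVec (fine n M) μ = bpt n M b (Function.update j μ ⟨(j μ : ℕ) + 1, h⟩) := by
  rw [bpt_eq_update_add n M b j μ, add_assoc, ← tstep_one', ← tstep_add, bpt_update_add_tstep n M b j μ ⟨(j μ : ℕ) + 1, h⟩]

omit hM in
/-- **translation across a block face**: `bpt b j + e_μ = bpt (b + e_μ) j[μ ↦ 0]` when `j_μ + 1 = n`. [folklore] -/
theorem bpt_add_unitVec_of_eq (b : Tor M) (j : Fin d → Fin n) (μ : Fin d) (h : (j μ : ℕ) + 1 = n) :
    bpt n M b j + unitVec (fine n M) μ = bpt n M (b + unitVec M μ) (Function.update j μ 0) := by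
  rw [bpt_eq_update_add n M b j μ, add_assoc, ← tstep_one', ← tstep_add, h, ← up_unitVec, bpt, bpt, add_right_comm, ← up_add]

/-- block and offsets of `x + e_μ`, interior case. [folklore] -/
theorem blockOf_offsF_add_of_lt (x : Tor (fine n M)) (μ : Fin d) (h : (offsF n M x μ : ℕ) + 1 < n) :
    blockOf n M (x + unitVec (fine n M) μ) = blockOf n M x
      ∧ offsF n M (x + unitVec (fine n M) μ) = Function.update (offsF n M x) μ ⟨(offsF n M x μ : ℕ) + 1, h⟩ := by
  rw [show x + unitVec (fine n M) μ = bpt n M (blockOf n M x) (offsF n M x) + unitVec (fine n M) μ by rw [bpt_blockOf_offsF],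
    bpt_add_unitVec_of_lt n M _ _ μ h, blockOf_bpt, offsF_bpt]
  exact ⟨rfl, rfl⟩

/-- block and offsets of `x + e_μ`, face case. [folklore] -/
theorem blockOf_offsF_add_of_eq (x : Tor (fine n M)) (μ : Fin d) (h : (offsF n M x μ : ℕ) + 1 = n) :
    blockOf n M (x + unitVec (fine n M) μ) = blockOf n M x + unitVec M μ
      ∧ offsF n M (x + unitVec (fine n M) μ) = Function.update (offsF n M x) μ 0 := by
  rw [show x + unitVec (fine n M) μ = bpt n M (blockOf n M x) (offsF n M x) + unitVec (fine n M) μ by rw [bpt_blockOf_offsF],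
    bpt_add_unitVec_of_eq n M _ _ μ h, blockOf_bpt, offsF_bpt]
  exact ⟨rfl, rfl⟩

/-- block and offsets of `x − e_μ`: either the offset drops by one inside the block (`offsF x μ ≠ 0`), or `x − e_μ` is the last layer
of the block below (`offsF x μ = 0`). [folklore] -/
theorem blockOf_offsF_sub (x : Tor (fine n M)) (μ : Fin d) :
    ((offsF n M x μ : ℕ) ≠ 0 ∧ blockOf n M (x - unitVec (fine n M) μ) = blockOf n M x
        ∧ (offsF n M (x - unitVec (fine n M) μ) μ : ℕ) = (offsF n M x μ : ℕ) - 1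
        ∧ ∀ ν, ν ≠ μ → offsF n M (x - unitVec (fine n M) μ) ν = offsF n M x ν)
    ∨ ((offsF n M x μ : ℕ) = 0 ∧ blockOf n M (x - unitVec (fine n M) μ) = blockOf n M x - unitVec M μ
        ∧ (offsF n M (x - unitVec (fine n M) μ) μ : ℕ) = n - 1
        ∧ ∀ ν, ν ≠ μ → offsF n M (x - unitVec (fine n M) μ) ν = offsF n M x ν) := by
  set w := x - unitVec (fine n M) μ with hw
  have hx : x = w + unitVec (fine n M) μ := by rw [hw, sub_add_cancel]
  rcases Nat.lt_or_ge ((offsF n M w μ : ℕ) + 1) n with hlt | hge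
  · obtain ⟨hb, ho⟩ := blockOf_offsF_add_of_lt n M w μ hlt
    rw [← hx] at hb ho
    refine Or.inl ⟨?_, hb.symm, ?_, fun ν hν => ?_⟩
    · rw [ho, Function.update_self]; exact Nat.succ_ne_zero _
    · rw [ho, Function.update_self]; rfl
    · rw [ho, Function.update_of_ne hν]
  · have heq : (offsF n M w μ : ℕ) + 1 = n := le_antisymm (offsF n M w μ).isLt hge
    obtain ⟨hb, ho⟩ := blockOf_offsF_add_of_eq n M w μ heq
    rw [← hx] at hb ho
    refine Or.inr ⟨?_, ?_, ?_, fun ν hν => ?_⟩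
    · rw [ho, Function.update_self, Fin.val_zero]
    · rw [hb, add_sub_cancel_right]
    · omega
    · rw [ho, Function.update_of_ne hν]

end Blocks

/-! ## §3 The vertex bumps: an exact partition of unity by product smoothstep bumps -/

section Bumps

variable (n : ℕ) [NeZero n] (M : Fin d → ℕ) [hM : ∀ μ, NeZero (M μ)]

/-- the axis factor of the bump of the vertex coordinate `c`: `rampUp` on the LOWER block (`b + 1 = c`), `rampDn` on the UPPER block
(`b = c`), `0` elsewhere (written as a sum of two indicator terms). [folklore] -/
def axisF {m : ℕ} (c b : ZMod m) (t : ℕ) : ℝ := (if c = b + 1 then rampUp n t else 0) + (if c = b then rampDn n t else 0)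

/-- **the bump of the vertex `v`** (the corner shared by the `2^d` blocks `b` with `b_ν ∈ {v_ν − 1, v_ν}`):
`bump v x = Π_ν axisF (v ν) (blockOf x ν) (offsF x ν)`. [folklore] -/
def bump (v : Tor M) (x : Tor (fine n M)) : ℝ := ∏ ν, axisF n (v ν) (blockOf n M x ν) (offsF n M x ν : ℕ)

omit [NeZero n] hM in
/-- the axis factors sum to `1` over the vertex coordinate: `Σ_c axisF c b t = rampUp t + rampDn t = 1`. [folklore] -/
theorem sum_axisF {m : ℕ} [NeZero m] (b : ZMod m) (t : ℕ) : ∑ c : ZMod m, axisF n c b t = 1 := by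
  simp only [axisF, Finset.sum_add_distrib, Finset.sum_ite_eq', Finset.mem_univ, if_true, rampDn]
  ring

omit [NeZero n] hM in
/-- `0 ≤ axisF ≤ 1` on a block (`2 ≤ n`). [folklore] -/
theorem axisF_mem (hn : 2 ≤ n) {m : ℕ} (c b : ZMod m) {t : ℕ} (ht : t + 1 ≤ n) : 0 ≤ axisF n c b t ∧ axisF n c b t ≤ 1 := by
  have hu := rampUp_mem hn ht
  have hd := rampDn_mem hn ht
  unfold axisF
  by_cases h1 : c = b + 1
  · by_cases h2 : c = b
    · rw [if_pos h1, if_pos h2, rampDn]; constructor <;> linarith [hu.1]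
    · rw [if_pos h1, if_neg h2, add_zero]; exact hu
  · by_cases h2 : c = b
    · rw [if_neg h1, if_pos h2, zero_add]; exact hd
    · rw [if_neg h1, if_neg h2, add_zero]; exact ⟨le_rfl, zero_le_one⟩

/-- **EXACT PARTITION OF UNITY**: `Σ_v bump v x = 1` (the sum over vertices factorises axis by axis). [folklore] -/
theorem sum_bump (x : Tor (fine n M)) : ∑ v : Tor M, bump n M v x = 1 := by
  unfold bump
  rw [← Fintype.piFinset_univ, ← Finset.prod_univ_sum (fun _ => Finset.univ)
    (fun ν (c : ZMod (M ν)) => axisF n c (blockOf n M x ν) (offsF n M x ν : ℕ))]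
  exact Finset.prod_eq_one fun ν _ => sum_axisF n _ _

/-- `0 ≤ bump ≤ 1`. [folklore] -/
theorem bump_mem (hn : 2 ≤ n) (v : Tor M) (x : Tor (fine n M)) : 0 ≤ bump n M v x ∧ bump n M v x ≤ 1 := by
  unfold bump
  have h := fun ν => axisF_mem n hn (v ν) (blockOf n M x ν) (t := (offsF n M x ν : ℕ)) (offsF n M x ν).isLt
  exact ⟨Finset.prod_nonneg fun ν _ => (h ν).1, Finset.prod_le_one (fun ν _ => (h ν).1) fun ν _ => (h ν).2⟩

omit [NeZero n] hM in
/-- `bump v x ≠ 0` forces the block of `x` into the patch of `v`: `∀ ν, v ν = (blockOf x) ν + 1 ∨ v ν = (blockOf x) ν`, and the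
`ν`-factor is the corresponding ramp value. [folklore] -/
theorem axisF_ne_zero {m : ℕ} {c b : ZMod m} {t : ℕ} (h : axisF n c b t ≠ 0) :
    (c = b + 1 ∧ rampUp n t ≠ 0) ∨ (c = b ∧ rampDn n t ≠ 0) := by
  unfold axisF at h
  by_cases h1 : c = b + 1
  · by_cases hu : rampUp n t = 0
    · rw [if_pos h1, hu, zero_add] at h
      by_cases h2 : c = b
      · rw [if_pos h2] at h; exact Or.inr ⟨h2, h⟩
      · rw [if_neg h2] at h; exact absurd rfl h
    · exact Or.inl ⟨h1, hu⟩
  · rw [if_neg h1, zero_add] at h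
    by_cases h2 : c = b
    · rw [if_pos h2] at h; exact Or.inr ⟨h2, h⟩
    · rw [if_neg h2] at h; exact absurd rfl h

/-- each factor of a non-vanishing bump is non-zero. [folklore] -/
theorem axisF_ne_zero_of_bump_ne_zero {v : Tor M} {x : Tor (fine n M)} (h : bump n M v x ≠ 0) (ν : Fin d) :
    axisF n (v ν) (blockOf n M x ν) (offsF n M x ν : ℕ) ≠ 0 := fun h0 =>
  h (Finset.prod_eq_zero (Finset.mem_univ ν) h0)

/-- a sum over the vertex coordinate of two indicator terms: `Σ_c |[c = p]·a + [c = q]·b| ≤ |a| + |b|`. [folklore] -/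
theorem sum_abs_two_ite_le {m : ℕ} [NeZero m] (p q : ZMod m) (a b : ℝ) :
    ∑ c : ZMod m, |(if c = p then a else 0) + (if c = q then b else 0)| ≤ |a| + |b| := by
  calc ∑ c : ZMod m, |(if c = p then a else 0) + (if c = q then b else 0)|
      ≤ ∑ c : ZMod m, (|if c = p then a else 0| + |if c = q then b else 0|) := Finset.sum_le_sum fun c _ => abs_add_le _ _
    _ = |a| + |b| := by
        rw [Finset.sum_add_distrib]
        congr 1
        · rw [show (fun c : ZMod m => |if c = p then a else 0|) = fun c => if c = p then |a| else 0 by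
            funext c; split_ifs <;> simp, Finset.sum_ite_eq' Finset.univ p, if_pos (Finset.mem_univ _)]
        · rw [show (fun c : ZMod m => |if c = q then b else 0|) = fun c => if c = q then |b| else 0 by
            funext c; split_ifs <;> simp, Finset.sum_ite_eq' Finset.univ q, if_pos (Finset.mem_univ _)]

omit [NeZero n] hM in
/-- the axis combination for a FIRST difference regroups into two indicator terms when the block is unchanged. [folklore] -/
theorem axisF_sub_axisF_same {m : ℕ} (c b : ZMod m) (t t' : ℕ) :
    axisF n c b t' - axisF n c b t
      = (if c = b + 1 then rampUp n t' - rampUp n t else 0) + (if c = b then rampDn n t' - rampDn n t else 0) := by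
  unfold axisF; split_ifs <;> ring

end Bumps

end Summit.QuantumFields.BalabanUV.T4Continuum.DirichletMonotoneCutoff

end
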